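/-
Copyright (c) 2026. All rights reserved.
Released under Apache 2.0 license as described in the file LICENSE.
Authors: abc-iut cell, seat abc-iut-L6-t6 (functoriality of abc-iut-L1-d9's `Perfection.map` in the functor:
identities and composites; used for [IUTchIII] Ex. 3.6 (iii)).
-/
import Literature.AlgebraicGeometry.Frobenioids.PerfectionFunctoriality
import HarnessLib

/-!
# Frobenioids I, Theorem 3.4 (iii), the perfection square: `(−)^pf` is functorial ON THE NOSE —
# `(id_C)^pf = id_{C^pf}` and `(Ψ' ∘ Ψ)^pf = Ψ'^pf ∘ Ψ^pf` (proof-only)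

Mochizuki, *The geometry of Frobenioids I: the general theory*, Kyushu J. Math. **62** (2008) 293–400,
Definition 3.1 (ii)/(iii) pp. 56–57 and Theorem 3.4 (iii) p. 62 [cite: MochizukiFrdI2008, Thm. 3.4 (iii) p.62]:
"`Ψ` induces a `1`-unique functor `Ψ^pf : C₁^pf → C₂^pf` that fits into a `1`-commutative diagram". The file
`PerfectionFunctoriality.lean` (construction of `Ψ^pf = Perfection.map hΨ` for a Frobenius-compatible `Ψ`, from
CHOSEN comparison isomorphisms `Ψ(A^{(a)}) ≅ (Ψ A)^{(a)}` under `Ψ A`) leaves the dependence on those choices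
and the behaviour under composition implicit. This proof-only companion records that there is in fact no
choice and that `Ψ ↦ Ψ^pf` is strictly functorial:
* `frobPowIso_hom_unique` — the comparison isomorphism `Ψ(A^{(a)}) ≅ (Ψ A)^{(a)}` under `Ψ A` is UNIQUE (all
  arrows of a Frobenioid are epimorphisms, Def. 1.3 / `IsTotallyEpimorphic`), so `Ψ^pf` does not depend on
  the choice made in `Perfection.frobPowIso`;
* `map_id_eq` — for the identity functor (trivially Frobenius-compatible) `(𝟭 C)^pf = 𝟭 (C^pf)` as functors;
* `isFrobeniusCompatible_comp`, `repMap_comp`, `map_comp_eq` — for Frobenius-compatible `Ψ : C₁ → C₂`, `Ψ' : C₂ → C₃` and ANY compatibility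
  witness for `Ψ ⋙ Ψ'`, `(Ψ ⋙ Ψ')^pf = Ψ^pf ⋙ Ψ'^pf` as functors (same objects `(Ψ'Ψ A, n)`; on representatives
  the two conjugations agree by the uniqueness above).
Equalities of functors are legitimate here because both sides have literally the same object map. Only
`IsFrobenioid` of the three structure functors is used. Nothing here is specific to abc; no statement of the
paper is strengthened (print's `Ψ^pf` is `1`-unique; we record the strict functoriality of THE construction).
-/

namespace Literature.AlgebraicGeometry.Frobenioids

namespace PreFrobenioid

namespace Perfection

open CategoryTheory Opposite

universe w₁ v₁ v₁' u₁ u₁' w₂ v₂ v₂' u₂ u₂' w₃ v₃ v₃' u₃ u₃'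

variable {D₁ : Type u₁} [Category.{v₁} D₁] {Φ₁ : D₁ᵒᵖ ⥤ CommMonCat.{w₁}}
  {C₁ : Type u₁'} [Category.{v₁'} C₁] {F₁ : C₁ ⥤ ElemFrobenioid Φ₁} {hF₁ : IsFrobenioid F₁}
  {D₂ : Type u₂} [Category.{v₂} D₂] {Φ₂ : D₂ᵒᵖ ⥤ CommMonCat.{w₂}}
  {C₂ : Type u₂'} [Category.{v₂'} C₂] {F₂ : C₂ ⥤ ElemFrobenioid Φ₂} {hF₂ : IsFrobenioid F₂}
  {D₃ : Type u₃} [Category.{v₃} D₃] {Φ₃ : D₃ᵒᵖ ⥤ CommMonCat.{w₃}}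
  {C₃ : Type u₃'} [Category.{v₃'} C₃] {F₃ : C₃ ⥤ ElemFrobenioid Φ₃} {hF₃ : IsFrobenioid F₃}

/-! ### The comparison isomorphisms are unique -/

/-- **Uniqueness of the comparison `Ψ(A^{(a)}) ≅ (Ψ A)^{(a)}` under `Ψ A`**: any arrow `j` with
`Ψ(frob_A) ≫ j = frob_{Ψ A}` is `(frobPowIso A a).hom` — `Ψ(frob_A)` is an epimorphism (every arrow of the
Frobenioid `C₂` is). [cite: MochizukiFrdI2008, Def. 1.3 (ii) p.24] -/
theorem frobPowIso_hom_unique {G : C₁ ⥤ C₂} (hG : IsFrobeniusCompatible F₁ F₂ G) (A : C₁) (a : ℕ+)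
    {j : G.obj (frobPow hF₁ A a) ⟶ frobPow hF₂ (G.obj A) a}
    (hj : G.map (frob hF₁ A a) ≫ j = frob hF₂ (G.obj A) a) :
    j = (frobPowIso (hF₁ := hF₁) (hF₂ := hF₂) hG A a).hom := by
  haveI : Epi (G.map (frob hF₁ A a)) := hF₂.isPreFrobenioid.isTotallyEpimorphic.epi _
  exact (cancel_epi (G.map (frob hF₁ A a))).mp (hj.trans (map_frob_frobPowIso hG A a).symm)

/-! ### The identity functor -/

variable (F₁) in
/-- The identity functor is Frobenius-compatible. [cite: MochizukiFrdI2008, Thm. 3.4 (iii) p.62] -/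
theorem isFrobeniusCompatible_id : IsFrobeniusCompatible F₁ F₁ (𝟭 C₁) :=
  ⟨fun _ _ _ h => h, fun _ _ _ _ => rfl⟩

/-- For the identity functor the comparison isomorphism `A^{(a)} ≅ A^{(a)}` under `A` is the identity.
[cite: MochizukiFrdI2008, Def. 1.3 (ii) p.24] -/
theorem frobPowIso_id_hom (hId : IsFrobeniusCompatible F₁ F₁ (𝟭 C₁)) (A : C₁) (a : ℕ+) :
    (frobPowIso (hF₁ := hF₁) (hF₂ := hF₁) hId A a).hom = 𝟙 (frobPow hF₁ A a) :=
  (frobPowIso_hom_unique hId A a (by exact Category.comp_id _)).symm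

/-- For the identity functor the inverse comparison isomorphism is the identity.
[cite: MochizukiFrdI2008, Def. 1.3 (ii) p.24] -/
theorem frobPowIso_id_inv (hId : IsFrobeniusCompatible F₁ F₁ (𝟭 C₁)) (A : C₁) (a : ℕ+) :
    (frobPowIso (hF₁ := hF₁) (hF₂ := hF₁) hId A a).inv = 𝟙 (frobPow hF₁ A a) :=
  calc (frobPowIso (hF₁ := hF₁) (hF₂ := hF₁) hId A a).inv
        = (frobPowIso (hF₁ := hF₁) (hF₂ := hF₁) hId A a).inv ≫ (frobPowIso (hF₁ := hF₁) (hF₂ := hF₁) hId A a).hom := by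
          rw [frobPowIso_id_hom (hF₁ := hF₁) hId A a]
          exact (Category.comp_id _).symm
    _ = 𝟙 _ := (frobPowIso (hF₁ := hF₁) (hF₂ := hF₁) hId A a).inv_hom_id

/-- `(𝟭 C)^pf` is the identity on representatives. [cite: MochizukiFrdI2008, Thm. 3.4 (iii) p.62] -/
theorem repMap_id_functor (hId : IsFrobeniusCompatible F₁ F₁ (𝟭 C₁)) {X Y : Perfection hF₁} (r : Rep X Y) :
    repMap (hF₁ := hF₁) (hF₂ := hF₁) hId r = r := by
  obtain ⟨⟨a, b, e⟩, θ⟩ := r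
  change (⟨⟨a, b, e⟩, (frobPowIso (hF₁ := hF₁) (hF₂ := hF₁) hId X.obj a).inv ≫ θ ≫
      (frobPowIso (hF₁ := hF₁) (hF₂ := hF₁) hId Y.obj b).hom⟩ : Rep X Y) = ⟨⟨a, b, e⟩, θ⟩
  rw [frobPowIso_id_inv, frobPowIso_id_hom]
  congr 1
  exact (Category.id_comp _).trans (Category.comp_id _)

/-- **`(id_C)^pf = id_{C^pf}`** as functors (same objects `(A, n)`; on every class `[θ] ↦ [θ]`).
[cite: MochizukiFrdI2008, Thm. 3.4 (iii) p.62] -/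
theorem map_id_eq (hId : IsFrobeniusCompatible F₁ F₁ (𝟭 C₁)) :
    map (hF₁ := hF₁) (hF₂ := hF₁) hId = 𝟭 (Perfection hF₁) := by
  refine CategoryTheory.Functor.hext (fun X => rfl) (fun X Y f => ?_)
  obtain ⟨r, rfl⟩ := Hom.mk_surjective f
  exact heq_of_eq (by rw [map_mk, repMap_id_functor]; rfl)

/-! ### Composites -/

section Comp

variable {G : C₁ ⥤ C₂} {K : C₂ ⥤ C₃}

/-- The composite of Frobenius-compatible functors is Frobenius-compatible.
[cite: MochizukiFrdI2008, Thm. 3.4 (iii) p.62] -/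
theorem isFrobeniusCompatible_comp (hG : IsFrobeniusCompatible F₁ F₂ G) (hK : IsFrobeniusCompatible F₂ F₃ K) :
    IsFrobeniusCompatible F₁ F₃ (G ⋙ K) :=
  ⟨fun _ _ f h => hK.isFrobeniusType_map _ (hG.isFrobeniusType_map f h),
    fun _ _ f h => (hK.degFr_map _ (hG.isFrobeniusType_map f h)).trans (hG.degFr_map f h)⟩

variable (hG : IsFrobeniusCompatible F₁ F₂ G) (hK : IsFrobeniusCompatible F₂ F₃ K)
  (hGK : IsFrobeniusCompatible F₁ F₃ (G ⋙ K))

/-- The comparison isomorphism of the composite is the composite of the comparison isomorphisms: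
`j^{Ψ⋙Ψ'}_{A,a} = Ψ'(j^{Ψ}_{A,a}) ≫ j^{Ψ'}_{ΨA,a}` (uniqueness). [cite: MochizukiFrdI2008, Def. 1.3 (ii) p.24] -/
theorem frobPowIso_comp_hom (A : C₁) (a : ℕ+) :
    (frobPowIso (hF₁ := hF₁) (hF₂ := hF₃) hGK A a).hom =
      K.map (frobPowIso (hF₁ := hF₁) (hF₂ := hF₂) hG A a).hom ≫
        (frobPowIso (hF₁ := hF₂) (hF₂ := hF₃) hK (G.obj A) a).hom := by
  refine (frobPowIso_hom_unique hGK A a ?_).symm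
  change K.map (G.map (frob hF₁ A a)) ≫ K.map (frobPowIso hG A a).hom ≫ (frobPowIso hK (G.obj A) a).hom =
    frob hF₃ (K.obj (G.obj A)) a
  rw [← K.map_comp_assoc, map_frob_frobPowIso hG A a, map_frob_frobPowIso hK (G.obj A) a]

/-- … as isomorphisms. [cite: MochizukiFrdI2008, Def. 1.3 (ii) p.24] -/
theorem frobPowIso_comp (A : C₁) (a : ℕ+) :
    frobPowIso (hF₁ := hF₁) (hF₂ := hF₃) hGK A a =
      K.mapIso (frobPowIso (hF₁ := hF₁) (hF₂ := hF₂) hG A a) ≪≫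
        frobPowIso (hF₁ := hF₂) (hF₂ := hF₃) hK (G.obj A) a :=
  Iso.ext (frobPowIso_comp_hom (hF₂ := hF₂) hG hK hGK A a)

/-- … and for the inverses. [cite: MochizukiFrdI2008, Def. 1.3 (ii) p.24] -/
theorem frobPowIso_comp_inv (A : C₁) (a : ℕ+) :
    (frobPowIso (hF₁ := hF₁) (hF₂ := hF₃) hGK A a).inv =
      (frobPowIso (hF₁ := hF₂) (hF₂ := hF₃) hK (G.obj A) a).inv ≫
        K.map (frobPowIso (hF₁ := hF₁) (hF₂ := hF₂) hG A a).inv := by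
  rw [frobPowIso_comp (hF₂ := hF₂) hG hK hGK A a]
  rfl

/-- `(Ψ ⋙ Ψ')^pf` and `Ψ^pf ⋙ Ψ'^pf` agree on representatives (on the nose).
[cite: MochizukiFrdI2008, Thm. 3.4 (iii) p.62] -/
theorem repMap_comp {X Y : Perfection hF₁} (r : Rep X Y) :
    repMap (hF₁ := hF₁) (hF₂ := hF₃) hGK r =
      repMap (hF₁ := hF₂) (hF₂ := hF₃) hK (repMap (hF₁ := hF₁) (hF₂ := hF₂) hG r) := by
  obtain ⟨⟨a, b, e⟩, θ⟩ := r
  change (⟨⟨a, b, e⟩, (frobPowIso hGK X.obj a).inv ≫ K.map (G.map θ) ≫ (frobPowIso hGK Y.obj b).hom⟩ :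
      Rep (⟨K.obj (G.obj X.obj), X.idx⟩ : Perfection hF₃) ⟨K.obj (G.obj Y.obj), Y.idx⟩) =
    ⟨⟨a, b, e⟩, (frobPowIso hK (G.obj X.obj) a).inv ≫
      K.map ((frobPowIso hG X.obj a).inv ≫ G.map θ ≫ (frobPowIso hG Y.obj b).hom) ≫
        (frobPowIso hK (G.obj Y.obj) b).hom⟩
  rw [frobPowIso_comp_inv (hF₂ := hF₂) hG hK hGK, frobPowIso_comp_hom (hF₂ := hF₂) hG hK hGK]
  congr 1
  simp only [Functor.map_comp, Category.assoc]
  exact Category.assoc _ _ _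

/-- **`(Ψ ⋙ Ψ')^pf = Ψ^pf ⋙ Ψ'^pf`** as functors, for any compatibility witness of the composite.
[cite: MochizukiFrdI2008, Thm. 3.4 (iii) p.62] -/
theorem map_comp_eq :
    map (hF₁ := hF₁) (hF₂ := hF₃) hGK =
      map (hF₁ := hF₁) (hF₂ := hF₂) hG ⋙ map (hF₁ := hF₂) (hF₂ := hF₃) hK := by
  refine CategoryTheory.Functor.hext (fun X => rfl) (fun X Y f => ?_)
  obtain ⟨r, rfl⟩ := Hom.mk_surjective f
  exact heq_of_eq (congrArg Hom.mk (repMap_comp hG hK hGK r))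

/-- `(Ψ ⋙ Ψ')^pf = Ψ^pf ⋙ Ψ'^pf` with the canonical compatibility witness of the composite.
[cite: MochizukiFrdI2008, Thm. 3.4 (iii) p.62] -/
theorem map_comp_eq' :
    map (hF₁ := hF₁) (hF₂ := hF₃) (isFrobeniusCompatible_comp hG hK) =
      map (hF₁ := hF₁) (hF₂ := hF₂) hG ⋙ map (hF₁ := hF₂) (hF₂ := hF₃) hK :=
  map_comp_eq hG hK _

end Comp

end Perfection

end PreFrobenioid

end Literature.AlgebraicGeometry.Frobenioids
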